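import Summits.ValiantsHypothesis.ValiantsHypothesis.Theses.BorderApolarity
import Summits.ValiantsHypothesis.ValiantsHypothesis.Theorems.ToricFixedPoints.Negative.WithoutOrbitFalse
import Literature.Computability.AlgebraicComplexity.Apolarity
import Literature.Computability.AlgebraicComplexity.ApolarityAction

/-!
# Line `padding-flow-semiattraction` for crux `BorderApolarity.ToricFixedPoints` (stmt-ValiantsHypothesis-5779)

Skeleton (crux-plan opening, round 1; planner-cruxplan-stmt-ValiantsHypothesis-5779-padding-flow-semiatt-0, 2026-08-16)
for the crux idea `padding-flow-semiattraction` (crux-ideate r1, ideator 2; triage r1-1/2/3: pass-with-note = UNREAD).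

RECONSTRUCTION NOTICE. The idea card (`payload.idea.card_path`, a session folder of ideator 2) is not mounted on
this hub, was never published under `Cruxes/ToricFixedPoints/Ideas/`, is not item evidence and not in the summit
idea index; all three triagers abstained on it for that reason. This line is therefore rebuilt from the slug and
from the structure of the crux, and says so in its card (`Lines/padding-flow-semiattraction.md`).

THE CRUX (route `BorderApolarity`, rank 3). For `3 ≤ n ≤ m`: every `H₀(n,m)`-stable degree-wise Kuratowski limit
`J = (J_k)_{k ≤ m}` of annihilators `Ann_k(P_t)`, `P_t ∈ GL_{m²}·det_m`, is the Kuratowski limit of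
`Ann_k(u·diag((t+2)^w)·g·det_m)` for some `u, g ∈ GL_{m²}`, `w ∈ ℤ^{m²}` (a translate of a toric = Gröbner
degeneration of a translate).

THE STRUCTURAL FACT BEHIND THE NAME. Write `W* = Y' ⊕ Z`, `Y' = {ℓ = X₀₀} ∪ Y` (the `n²+1` positions of
`rk < m²`), `Z` the `N = m² − n² − 1` padding positions (`rk ≥ m²`, ordered by `rk`). A PADDING COCHARACTER is
`π_p(s) = diag(s^{-p})`, `p = 0` on `Y'`, `p < 0` on `Z`, strictly decreasing along `rk` (in the crux's
parametrisation `x_i ↦ (t+2)^{p_i} x_i`, `t → ∞`: the padding variables are contracted, the higher-`rk` ones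
faster). Then the crux's group is EXACTLY
  `H₀(n,m) = (T' · T_Z) ⋉ R_u(P⁻(π_p))`,
`T'` = the rank-one torus pattern on `Y'` with the character condition (iv), `T_Z` the padding torus, and
`R_u(P⁻(π_p)) = U_P · N_Z` (conditions (i)–(ii): "lower every `∂_ℓ, ∂_Y` into the `∂_z`, every `∂_z` into
higher-`rk` `∂_z'`") = ALL root directions of negative `π_p`-weight. On a `GL`-orbit closure the points killed by
every negative-weight root direction of a cocharacter are the points of its Białynicki-Birula SINK side; an
`H₀`-fixed limit ideal is "semi-attracting for the padding flow": killed by `𝔲⁻(π_p)`, fixed by `π_p`.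
THESIS OF THE LINE: `H₀`-fixed points of `Z_det` are PADDING-MINIMAL degenerations — limits of the padding-graded
toric points `Y(g) := K-lim_s Ann(diag((s+2)^p)·g·det_m)` ("contract the padding variables of ONE interior point
first"), and inside the closure of that explicit family an `H₀`-fixed point sits in a single diagonal-torus orbit
closure; torus-orbit geometry then yields one cocharacter, and a two-scale toric limit is a one-scale one.

THE FOUR REGISTERED STUBS (then the kernel-checked composition `ToricFixedPoints_of`, sorry-free outside them):
* `stub_semiattraction` (NEW; L–XL) — Stage 1: an `H₀`-stable border-apolar limit `J` of translates of `det_m`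
  is the Kuratowski limit of a SEQUENCE OF PADDING-GRADED TORIC POINTS `Y_t = K-lim_s Ann(diag((s+2)^p)·g_t·det_m)`
  for one padding weight `p` (uses the orbit hypothesis: `P_t = g_t·det_m`).
* `stub_torusHull` (CORE BET, HARDEST; XL) — Stage 2: an `H₀`-stable Kuratowski limit of padding-graded toric points
  (same `p`) lies in the closure of the diagonal-torus orbit of ONE of them: `J = K-lim_t d_t ⋆ Y₀`,
  `Y₀ = K-lim_s Ann(diag((s+2)^p)·g₀·det_m)`, `d_t ⋆` = image under `linSubst (diagonal d_t)`.  At `m = n`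
  (`p ≡ 0`, no padding) this is the crux itself in single-torus-hull form — the padding flow is silent there.
* `stub_orbitFace` (TRUE toric geometry; L) — orbit–face correspondence for the closure of a torus orbit in a
  product of Grassmannians, sequentially: a Kuratowski limit of diagonal-torus translates `d_t ⋆ Y₀` of a fixed
  graded point is the limit along ONE cocharacter of ONE translate, `((t+2)^μ · d₀) ⋆ Y₀`.
* `stub_lexRefinement` (TRUE Gröbner-fan bookkeeping; M–L) — `K-lim_t ((t+2)^μ d₀) ⋆ K-lim_s Ann(D^p_s g₀ det)`
  `= K-lim_t Ann(D^{Np−μ}_t · diag(d₀⁻¹) g₀ · det)` for `N ≫ 0` (`in_μ ∘ in_p = in_{Np+μ}`; `c ⋆ Ann(f) =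
  Ann(diag(c⁻¹)·f)` by `apolarAction_linSubst`), i.e. the crux's conclusion with `u = 1`.

DISPROOF / NEGATIVES HONOURED. `Disproof.lean` itself is not readable on this hub (`run/gate/evidence` unmounted, no crux
workfile); its landed conclusive part IS imported above:
`Summit.ValiantsHypothesis.Cruxes.ToricFixedPoints.Negative.toricFixedPoints_false_without_orbit` (p70156) — any
proof must use `P_t ∈ GL·det_m`; this line uses it in `stub_semiattraction` (the graded approximants are built from
the `g_t` with `P_t = g_t·det_m`; for `P_t = 0`, `J_k = everything` no such approximants exist), and no stub is an
instance of `ToricFixedPointsWithoutOrbit` (stubs 2–4 carry `det_m` explicitly). §0 ConstantCase (interior fixed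
point, `u = 1, w = 0`) is reproduced by the chain with `Y_t` constant, `d ≡ 1`, `μ = 0`, `w = 0`.
`ledger negatives --problem ValiantsHypothesis` (5668, 0340, 3735, 3738): unrelated; no stub restates one.

Conventions: `linSubst A : X_i ↦ Σ_j A_{ji} X_j`; `Ann(A·f) = linSubst((Aᵀ)⁻¹)(Ann f)`
(`apolarAction_linSubst_eq_zero_iff`), so for diagonal `c`, `c ⋆ Ann_k(f) := linSubst(diag c)(Ann_k f) =
Ann_k(diag(c⁻¹)·f)`; Kuratowski limits are the two clauses (Li),(Ls) of `IsBorderApolarLimit` (= the crux's,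
`apolarAction` being its inline `act` token for token).
-/

namespace Summit.ValiantsHypothesis.ValiantsHypothesis.Cruxes.ToricFixedPoints.PaddingFlowSemiattraction

open Literature.Computability.AlgebraicComplexity
open scoped BigOperators Matrix

set_option linter.unusedVariables false
set_option linter.dupNamespace false

/-! ## The four registered stubs -/

/-- **Stub 1 — padding-flow semi-attraction (Stage 1; NEW).**  For `3 ≤ n ≤ m`, an `H₀(n,m)`-stable border-apolar
limit `J` of a sequence `P_t ∈ GL·det_m` is the Kuratowski limit (degrees `≤ m`, both clauses) of a sequence of
PADDING-GRADED TORIC POINTS: there are a padding weight `p` (`p = 0` on the positions of `rk < m²`, i.e. on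
`Y' = {ℓ} ∪ Y`; `p < 0` and strictly decreasing along `rk` on the padding positions) and `g_t ∈ GL` such that the
toric limits `Y_t := K-lim_s Ann(diag((s+2)^p)·g_t·det_m)` (padding variables of ONE interior point contracted,
higher `rk` faster) exist and `Y_t ⟶ J`.
Why plausibly true: `H₀ = (T'·T_Z) ⋉ R_u(P⁻(π_p))` — `J` is fixed by the padding flow and killed by ALL its
negative-weight root directions, the signature of the sink side of the Białynicki-Birula decomposition of `Z_det`
for `π_p`, whose `O`-part retracts onto exactly these graded points (`p_π(g·x) = Y(g)`); the claim is that `J`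
lies in the closure of `p_π(O)`, not merely of `O`.  Every `H₀`-fixed point in the refuters' corpora (toric samples,
two-step points `in_λ(u·arc-limit)` with `z`-dominant `λ`, triage r1-2 A2/A4) is of this kind or a limit of such.
`m = n`: `p ≡ 0` and `Y_t = Ann(g_t·det_n)` — the hypothesis itself (trivially true there).  Uses the orbit
hypothesis (honours `toricFixedPoints_false_without_orbit`).  Size L–XL. [folklore] -/
theorem stub_semiattraction :
    ∀ (n m : ℕ) [NeZero m], 3 ≤ n → n ≤ m →
    let rk := fun (p : Fin m × Fin m) =>
      (if (m - n ≤ (p.1 : ℕ) ∧ m - n ≤ (p.2 : ℕ)) ∨ p = (0, 0) then 0 else m * m) + ((p.1 : ℕ) * m + (p.2 : ℕ));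
    ∀ (P : ℕ → MvPolynomial (Fin m × Fin m) ℂ) (J : ℕ → Set (MvPolynomial (Fin m × Fin m) ℂ)),
      (∀ t : ℕ, P t ∈ glOrbit (Fin m × Fin m) ℂ (detPoly (Fin m) ℂ)) →
      IsBorderApolarLimit m P J →
      (∀ A : Matrix.GeneralLinearGroup (Fin m × Fin m) ℂ,
        let M : Matrix (Fin m × Fin m) (Fin m × Fin m) ℂ := A;
        (∀ i j : Fin m × Fin m, M j i ≠ 0 → rk j ≤ rk i) →
        (∀ i j : Fin m × Fin m, ((m - n ≤ (i.1 : ℕ) ∧ m - n ≤ (i.2 : ℕ)) ∨ i = (0, 0)) → j ≠ i → M j i = 0) →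
        (∀ i k j l : Fin m, m - n ≤ (i : ℕ) → m - n ≤ (k : ℕ) → m - n ≤ (j : ℕ) → m - n ≤ (l : ℕ) →
          M (i, j) (i, j) * M (k, l) (k, l) = M (i, l) (i, l) * M (k, j) (k, j)) →
        M (0, 0) (0, 0) ^ (m - n) * ∏ i ∈ Finset.univ.filter (fun i : Fin m => m - n ≤ (i : ℕ)), M (i, i) (i, i) = 1 →
        ∀ k ≤ m, ∀ D ∈ J k, linSubst (Fin m × Fin m) ℂ Mᵀ D ∈ J k) →
      ∃ (p : Fin m × Fin m → ℤ) (g : ℕ → Matrix.GeneralLinearGroup (Fin m × Fin m) ℂ)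
        (Y : ℕ → ℕ → Set (MvPolynomial (Fin m × Fin m) ℂ)),
        ((∀ i : Fin m × Fin m, rk i < m * m → p i = 0) ∧ (∀ i : Fin m × Fin m, m * m ≤ rk i → p i < 0) ∧
          (∀ i j : Fin m × Fin m, m * m ≤ rk i → rk i < rk j → p j < p i)) ∧
        (∀ t : ℕ, IsBorderApolarLimit m
          (fun s : ℕ => linSubst (Fin m × Fin m) ℂ
            (Matrix.diagonal fun i : Fin m × Fin m => ((s : ℂ) + 2) ^ (p i))
            (linSubst (Fin m × Fin m) ℂ (g t : Matrix (Fin m × Fin m) (Fin m × Fin m) ℂ) (detPoly (Fin m) ℂ)))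
          (Y t)) ∧
        (∀ k ≤ m, ∀ D ∈ J k, ∃ Ds : ℕ → MvPolynomial (Fin m × Fin m) ℂ,
          (∀ t, Ds t ∈ Y t k) ∧
            Filter.Tendsto (fun t => coeffVec (Ds t)) Filter.atTop (nhds (coeffVec D))) ∧
        (∀ k ≤ m, ∀ (D : MvPolynomial (Fin m × Fin m) ℂ) (φ : ℕ → ℕ) (Ds : ℕ → MvPolynomial (Fin m × Fin m) ℂ),
          StrictMono φ → (∀ t, Ds t ∈ Y (φ t) k) →
            Filter.Tendsto (fun t => coeffVec (Ds t)) Filter.atTop (nhds (coeffVec D)) → D ∈ J k) := by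
  sorry

/-- **Stub 2 — single torus hull inside the padding-graded family (Stage 2; the CORE BET, hardest).**  For
`3 ≤ n ≤ m` and a padding weight `p`: if `J` is `H₀(n,m)`-stable and is the Kuratowski limit of padding-graded
toric points `Y_t = K-lim_s Ann(diag((s+2)^p)·g_t·det_m)`, then `J` lies in the closure of the DIAGONAL-TORUS
ORBIT of ONE such point: `J = K-lim_t d_t ⋆ Y₀` with `Y₀ = K-lim_s Ann(diag((s+2)^p)·g₀·det_m)` and invertible
diagonal scalings `d_t` (`d ⋆ S` = image of `S` under `linSubst (diagonal d)`, i.e. `Ann` of the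
`diag(d⁻¹)`-translate).
Why plausibly true: this is the crux transferred to the explicit family `P_pad = {Y(g)} = p_π(O)` (parametrised
by `g` through the `Y'`-restriction `A₀ = (g·X)|_{Z=0}` and the `rk`-ordered `z`-jets of the minors;
`GL(Y') × T_Z`-equivariant; every member `z`-multigraded with End-type `z`-free skeleton = minors of `A₀(Y')`),
where "closure of a union of torus orbits versus union of their closures" is a state-polytope question for
bideterminant spans instead of a question about the unknown boundary of `Z_det`; for the points the route
consumes (`J_m = Ann_m(ℓ^{m−n}per_n)`, `n ≥ 3`) the maximal torus of `Stab(J)°` is `T̃_H = ℂ*_ℓ × T^{rk1} × T_Z`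
(triage r1-1/2/3), so a single torus is forced there.  Strictly contains the `m = n` case of the crux
(`p ≡ 0`, `Y_t = Ann(g_t det_n)`) and, for `m > n`, asserts PADDING-MINIMALITY of `H₀`-fixed points (a
consequence of semi-attraction the crux itself does not demand) — the line's bet; cheapest kill: an `H₀`-fixed
`in_w(g·x)` with `w` NOT padding-dominant and no padding-dominant representation, at `(3,4)` or `(3,5)`.
Size XL. [folklore] -/
theorem stub_torusHull :
    ∀ (n m : ℕ) [NeZero m], 3 ≤ n → n ≤ m →
    let rk := fun (p : Fin m × Fin m) =>
      (if (m - n ≤ (p.1 : ℕ) ∧ m - n ≤ (p.2 : ℕ)) ∨ p = (0, 0) then 0 else m * m) + ((p.1 : ℕ) * m + (p.2 : ℕ));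
    ∀ (J : ℕ → Set (MvPolynomial (Fin m × Fin m) ℂ)),
      (∀ A : Matrix.GeneralLinearGroup (Fin m × Fin m) ℂ,
        let M : Matrix (Fin m × Fin m) (Fin m × Fin m) ℂ := A;
        (∀ i j : Fin m × Fin m, M j i ≠ 0 → rk j ≤ rk i) →
        (∀ i j : Fin m × Fin m, ((m - n ≤ (i.1 : ℕ) ∧ m - n ≤ (i.2 : ℕ)) ∨ i = (0, 0)) → j ≠ i → M j i = 0) →
        (∀ i k j l : Fin m, m - n ≤ (i : ℕ) → m - n ≤ (k : ℕ) → m - n ≤ (j : ℕ) → m - n ≤ (l : ℕ) →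
          M (i, j) (i, j) * M (k, l) (k, l) = M (i, l) (i, l) * M (k, j) (k, j)) →
        M (0, 0) (0, 0) ^ (m - n) * ∏ i ∈ Finset.univ.filter (fun i : Fin m => m - n ≤ (i : ℕ)), M (i, i) (i, i) = 1 →
        ∀ k ≤ m, ∀ D ∈ J k, linSubst (Fin m × Fin m) ℂ Mᵀ D ∈ J k) →
      ∀ (p : Fin m × Fin m → ℤ) (g : ℕ → Matrix.GeneralLinearGroup (Fin m × Fin m) ℂ)
        (Y : ℕ → ℕ → Set (MvPolynomial (Fin m × Fin m) ℂ)),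
        ((∀ i : Fin m × Fin m, rk i < m * m → p i = 0) ∧ (∀ i : Fin m × Fin m, m * m ≤ rk i → p i < 0) ∧
          (∀ i j : Fin m × Fin m, m * m ≤ rk i → rk i < rk j → p j < p i)) →
        (∀ t : ℕ, IsBorderApolarLimit m
          (fun s : ℕ => linSubst (Fin m × Fin m) ℂ
            (Matrix.diagonal fun i : Fin m × Fin m => ((s : ℂ) + 2) ^ (p i))
            (linSubst (Fin m × Fin m) ℂ (g t : Matrix (Fin m × Fin m) (Fin m × Fin m) ℂ) (detPoly (Fin m) ℂ)))
          (Y t)) →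
        (∀ k ≤ m, ∀ D ∈ J k, ∃ Ds : ℕ → MvPolynomial (Fin m × Fin m) ℂ,
          (∀ t, Ds t ∈ Y t k) ∧
            Filter.Tendsto (fun t => coeffVec (Ds t)) Filter.atTop (nhds (coeffVec D))) →
        (∀ k ≤ m, ∀ (D : MvPolynomial (Fin m × Fin m) ℂ) (φ : ℕ → ℕ) (Ds : ℕ → MvPolynomial (Fin m × Fin m) ℂ),
          StrictMono φ → (∀ t, Ds t ∈ Y (φ t) k) →
            Filter.Tendsto (fun t => coeffVec (Ds t)) Filter.atTop (nhds (coeffVec D)) → D ∈ J k) →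
      ∃ (g₀ : Matrix.GeneralLinearGroup (Fin m × Fin m) ℂ) (Y₀ : ℕ → Set (MvPolynomial (Fin m × Fin m) ℂ))
        (d : ℕ → Fin m × Fin m → ℂ),
        IsBorderApolarLimit m
          (fun s : ℕ => linSubst (Fin m × Fin m) ℂ
            (Matrix.diagonal fun i : Fin m × Fin m => ((s : ℂ) + 2) ^ (p i))
            (linSubst (Fin m × Fin m) ℂ (g₀ : Matrix (Fin m × Fin m) (Fin m × Fin m) ℂ) (detPoly (Fin m) ℂ)))
          Y₀ ∧
        (∀ t i, d t i ≠ 0) ∧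
        (∀ k ≤ m, ∀ D ∈ J k, ∃ Ds : ℕ → MvPolynomial (Fin m × Fin m) ℂ,
          (∀ t, ∃ E ∈ Y₀ k, Ds t = linSubst (Fin m × Fin m) ℂ (Matrix.diagonal (d t)) E) ∧
            Filter.Tendsto (fun t => coeffVec (Ds t)) Filter.atTop (nhds (coeffVec D))) ∧
        (∀ k ≤ m, ∀ (D : MvPolynomial (Fin m × Fin m) ℂ) (φ : ℕ → ℕ) (Ds : ℕ → MvPolynomial (Fin m × Fin m) ℂ),
          StrictMono φ → (∀ t, ∃ E ∈ Y₀ k, Ds t = linSubst (Fin m × Fin m) ℂ (Matrix.diagonal (d (φ t))) E) →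
            Filter.Tendsto (fun t => coeffVec (Ds t)) Filter.atTop (nhds (coeffVec D)) → D ∈ J k) := by
  sorry

/-- **Stub 3 — orbit–face correspondence, sequential form (TRUE toric geometry).**  Let `Y₀` be a padding-graded
toric point (`Y₀ = K-lim_s Ann(diag((s+2)^p)·g₀·det_m)`; only used qualitatively: each `Y₀ k`, `k ≤ m`, is a
linear subspace of degree-`k` forms — `IsBorderApolarLimit.isHomogeneous_of_mem`, and `liminf = limsup` is closed
under sums).  If `J` is the Kuratowski limit of diagonal-torus translates `d_t ⋆ Y₀` (`d_t` invertible diagonal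
scalings of the `∂_i`), then `J` is the limit along ONE cocharacter of ONE translate:
`J = K-lim_t ((t+2)^μ · d₀) ⋆ Y₀`.
Why true: the tuple `(Y₀ k)_{k ≤ m}` is a point of `Π_k Gr(a_k, ℂ[∂]_k)`, the diagonal torus `(ℂ*)^{m²}` acts
linearly (Plücker + Segre: a projective, possibly non-normal, toric variety `X_A = closure of the orbit`); a
Kuratowski limit with both clauses of constant-dimensional subspaces is a Grassmannian limit, so `J ∈ X_A`; torus
orbits of `X_A` ↔ faces `F` of the weight polytope, and every point of the orbit `O_F` is `lim_{s→0} s^ν·(d₀·Y₀)`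
for any `ν` whose face is `F` (Gelfand–Kapranov–Zelevinsky Ch. 5 Prop. 1.9; Cox–Little–Schenck Prop. 3.2.2,
Thm. 3.A.x for `X_A`); put `s = (t+2)^{-1}`, `μ = −ν`; Grassmannian convergence gives both Kuratowski clauses
(`GradedLimit.finrank_grSub` is the one-parameter dimension count already in tree).  Size L. [folklore] -/
theorem stub_orbitFace :
    ∀ (m : ℕ) (p : Fin m × Fin m → ℤ) (g₀ : Matrix.GeneralLinearGroup (Fin m × Fin m) ℂ)
      (Y₀ J : ℕ → Set (MvPolynomial (Fin m × Fin m) ℂ)) (d : ℕ → Fin m × Fin m → ℂ),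
      IsBorderApolarLimit m
          (fun s : ℕ => linSubst (Fin m × Fin m) ℂ
            (Matrix.diagonal fun i : Fin m × Fin m => ((s : ℂ) + 2) ^ (p i))
            (linSubst (Fin m × Fin m) ℂ (g₀ : Matrix (Fin m × Fin m) (Fin m × Fin m) ℂ) (detPoly (Fin m) ℂ)))
          Y₀ →
      (∀ t i, d t i ≠ 0) →
      (∀ k ≤ m, ∀ D ∈ J k, ∃ Ds : ℕ → MvPolynomial (Fin m × Fin m) ℂ,
          (∀ t, ∃ E ∈ Y₀ k, Ds t = linSubst (Fin m × Fin m) ℂ (Matrix.diagonal (d t)) E) ∧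
            Filter.Tendsto (fun t => coeffVec (Ds t)) Filter.atTop (nhds (coeffVec D))) →
      (∀ k ≤ m, ∀ (D : MvPolynomial (Fin m × Fin m) ℂ) (φ : ℕ → ℕ) (Ds : ℕ → MvPolynomial (Fin m × Fin m) ℂ),
          StrictMono φ → (∀ t, ∃ E ∈ Y₀ k, Ds t = linSubst (Fin m × Fin m) ℂ (Matrix.diagonal (d (φ t))) E) →
            Filter.Tendsto (fun t => coeffVec (Ds t)) Filter.atTop (nhds (coeffVec D)) → D ∈ J k) →
      ∃ (d₀ : Fin m × Fin m → ℂ) (μ : Fin m × Fin m → ℤ),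
        (∀ i, d₀ i ≠ 0) ∧
        (∀ k ≤ m, ∀ D ∈ J k, ∃ Ds : ℕ → MvPolynomial (Fin m × Fin m) ℂ,
          (∀ t, ∃ E ∈ Y₀ k, Ds t = linSubst (Fin m × Fin m) ℂ
              (Matrix.diagonal fun i : Fin m × Fin m => ((t : ℂ) + 2) ^ (μ i) * d₀ i) E) ∧
            Filter.Tendsto (fun t => coeffVec (Ds t)) Filter.atTop (nhds (coeffVec D))) ∧
        (∀ k ≤ m, ∀ (D : MvPolynomial (Fin m × Fin m) ℂ) (φ : ℕ → ℕ) (Ds : ℕ → MvPolynomial (Fin m × Fin m) ℂ),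
          StrictMono φ →
            (∀ t, ∃ E ∈ Y₀ k, Ds t = linSubst (Fin m × Fin m) ℂ
              (Matrix.diagonal fun i : Fin m × Fin m => (((φ t : ℕ) : ℂ) + 2) ^ (μ i) * d₀ i) E) →
            Filter.Tendsto (fun t => coeffVec (Ds t)) Filter.atTop (nhds (coeffVec D)) → D ∈ J k) := by
  sorry

/-- **Stub 4 — lexicographic refinement: a two-scale toric limit is a one-scale toric family (TRUE).**  If
`Y₀ = K-lim_s Ann(diag((s+2)^p)·g₀·det_m)` and `J = K-lim_t ((t+2)^μ·d₀) ⋆ Y₀` (`d₀` invertible), then `J` is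
the Kuratowski limit of the annihilators of ONE toric family of the crux's shape,
`u·diag((t+2)^w)·g·det_m` — namely `u = 1`, `g = diag(d₀⁻¹)·g₀`, `w = N·p − μ` for `N ≫ 0`.
Why true: `c ⋆ Ann_k(f) = linSubst(diag c)(Ann_k f) = Ann_k(diag(c⁻¹)·f)` (`apolarAction_linSubst_eq_zero_iff`,
diagonal matrices are symmetric and commute), so `((t+2)^μ d₀) ⋆ Y₀ k = K-lim_s Ann_k(diag((s+2)^p)·diag((t+2)^{−μ})
·diag(d₀⁻¹)·g₀·det)`; and `Ann_k(f((s+2)^p (t+2)^{−μ} x)) = {Σ_e b_e (s+2)^{−⟨p,e⟩}(t+2)^{⟨μ,e⟩} ∂^e : Σ b_e ∂^e ∈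
Ann_k f}` is a FIXED subspace moved by a two-parameter diagonal torus, whose iterated initial subspace (first the
`p`-grading, then the `μ`-grading) equals the initial subspace for the single weight `N·p − μ`, `N ≫ 0` (finitely
many weights occur: Gröbner-fan / `in_μ(in_p V) = in_{Np+μ} V`, Sturmfels, *Gröbner bases and convex polytopes*,
Prop. 1.8 & Cor. 1.9; Mora–Robbiano 1988), with one-parameter limits = initial subspaces
(`GradedLimit.grSub`, `finrank_grSub`); substitute `s + 2 = (t+2)^N`.  Size M–L. [folklore] -/
theorem stub_lexRefinement :
    ∀ (m : ℕ) (p : Fin m × Fin m → ℤ) (g₀ : Matrix.GeneralLinearGroup (Fin m × Fin m) ℂ)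
      (Y₀ J : ℕ → Set (MvPolynomial (Fin m × Fin m) ℂ)) (d₀ : Fin m × Fin m → ℂ) (μ : Fin m × Fin m → ℤ),
      IsBorderApolarLimit m
          (fun s : ℕ => linSubst (Fin m × Fin m) ℂ
            (Matrix.diagonal fun i : Fin m × Fin m => ((s : ℂ) + 2) ^ (p i))
            (linSubst (Fin m × Fin m) ℂ (g₀ : Matrix (Fin m × Fin m) (Fin m × Fin m) ℂ) (detPoly (Fin m) ℂ)))
          Y₀ →
      (∀ i, d₀ i ≠ 0) →
      (∀ k ≤ m, ∀ D ∈ J k, ∃ Ds : ℕ → MvPolynomial (Fin m × Fin m) ℂ,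
          (∀ t, ∃ E ∈ Y₀ k, Ds t = linSubst (Fin m × Fin m) ℂ
              (Matrix.diagonal fun i : Fin m × Fin m => ((t : ℂ) + 2) ^ (μ i) * d₀ i) E) ∧
            Filter.Tendsto (fun t => coeffVec (Ds t)) Filter.atTop (nhds (coeffVec D))) →
      (∀ k ≤ m, ∀ (D : MvPolynomial (Fin m × Fin m) ℂ) (φ : ℕ → ℕ) (Ds : ℕ → MvPolynomial (Fin m × Fin m) ℂ),
          StrictMono φ →
            (∀ t, ∃ E ∈ Y₀ k, Ds t = linSubst (Fin m × Fin m) ℂ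
              (Matrix.diagonal fun i : Fin m × Fin m => (((φ t : ℕ) : ℂ) + 2) ^ (μ i) * d₀ i) E) →
            Filter.Tendsto (fun t => coeffVec (Ds t)) Filter.atTop (nhds (coeffVec D)) → D ∈ J k) →
      ∃ (u g : Matrix.GeneralLinearGroup (Fin m × Fin m) ℂ) (w : Fin m × Fin m → ℤ),
        IsBorderApolarLimit m
          (fun t : ℕ => linSubst (Fin m × Fin m) ℂ (u : Matrix (Fin m × Fin m) (Fin m × Fin m) ℂ)
            (linSubst (Fin m × Fin m) ℂ (Matrix.diagonal fun i : Fin m × Fin m => ((t : ℂ) + 2) ^ (w i))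
              (linSubst (Fin m × Fin m) ℂ (g : Matrix (Fin m × Fin m) (Fin m × Fin m) ℂ) (detPoly (Fin m) ℂ))))
          J := by
  sorry

/-! ## The composition (no `sorry` below this line) -/

/-- **The crux from the four stubs.**  Unfold the crux's `let`s; Stage 1 (`stub_semiattraction`, fed the orbit
hypothesis, the Kuratowski conjunction read as `IsBorderApolarLimit` by `rfl`, and the `H₀` clause verbatim) gives
padding-graded approximants; Stage 2 (`stub_torusHull`) one graded point `Y₀` and torus translates; Stage 3
(`stub_orbitFace`) one cocharacter; Stage 4 (`stub_lexRefinement`) one toric family, whose `IsBorderApolarLimit` is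
the crux's conclusion by `apolarAction = act` (token for token).  [folklore] -/
theorem ToricFixedPoints_of : Theses.BorderApolarity.ToricFixedPoints := by
  intro n m _ hn hnm
  dsimp only
  intro P J hO hL hH
  -- Stage 1: padding-graded toric approximants (semi-attraction); uses the orbit hypothesis
  have h₁ := stub_semiattraction n m hn hnm
  dsimp only at h₁
  obtain ⟨p, g, Y, hp, hY, hYi, hYs⟩ := h₁ P J hO hL hH
  -- Stage 2: single torus hull inside the padding-graded family
  have h₂ := stub_torusHull n m hn hnm
  dsimp only at h₂
  obtain ⟨g₀, Y₀, d, hY₀, hd, hJi, hJs⟩ := h₂ J hH p g Y hp hY hYi hYs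
  -- Stage 3: orbit–face correspondence: one cocharacter, one translate
  obtain ⟨d₀, μ, hd₀, hKi, hKs⟩ := stub_orbitFace m p g₀ Y₀ J d hY₀ hd hJi hJs
  -- Stage 4: lexicographic refinement: one toric family of the crux's shape
  obtain ⟨u, g', w, hfin⟩ := stub_lexRefinement m p g₀ Y₀ J d₀ μ hY₀ hd₀ hKi hKs
  exact ⟨u, g', w, hfin.1, hfin.2⟩

end Summit.ValiantsHypothesis.ValiantsHypothesis.Cruxes.ToricFixedPoints.PaddingFlowSemiattraction
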